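import Literature.InformationTheory.QuantumCodes.QuaternaryMacWilliams
import Literature.InformationTheory.QuantumCodes.SyndromeDecodingAdditive
import Literature.InformationTheory.QuantumCodes.CSS
import HarnessLib

/-!
# The check-weight constraint on the weight distribution (Wang–Liu–Li–Kubica–Gu 2026, Theorems IV.5 and IV.8)

LADDER-QEC, X1 (barriers) / census LP column, check-weight axis. Wang–Liu–Li–Kubica–Gu, *Check-weight-constrained
quantum codes: bounds and examples* (arXiv:2601.15446, 2026), §IV add to the CRSS / Kalachev–type linear programs ONE
linear constraint expressing «check weight `w`»: **Theorem IV.8** (stabilizer codes, p. 13): «Any stabilizer code with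
parameters `[[n,k,d]]`, primal … weight distribution `{A_i}` … and check weight `w` must satisfy
`Σ_{i ≤ mw} A_i ≥ Σ_{j=0}^{m} binom(n−k, j)` for `m = 0, …, ⌊n/w⌋`» — «any product of at most `m` linearly
independent checks gives a unique stabilizer of weight at most `mw`»; **Theorem IV.5** (CSS codes, p. 12): the same
for the `X`-stabilizer distribution `{A^X_i}` (words of `C_X^⊥ = rs H^X`, Definition IV.1) with `n − k_X` and for
`{A^Z_i}` with `n − k_Z`. These are the constraints behind the paper's finite-size upper bounds for weight-`w` codes
(Figs. 1(a), 5, 6, 9–11; Tables II–III).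

This file proves both AS PRINTED, from one counting lemma:

* `choose_sum_le_card_span_of_weight_le` — in an `𝔽₂`-space with a subadditive weight, `r` linearly independent
  vectors of weight `≤ w` give at least `Σ_{j ≤ m} binom(r, j)` distinct vectors of weight `≤ mw` in their span (the
  subset sums over at most `m` of them; injective by independence);
* **`WangLiuLiKubicaGu2026_theorem_IV8`** — for a stabilizer space `S̄ ≤ 𝔽₂^{2n}` (`SymplecticCodes.lean`) spanned by
  vectors of symplectic weight `≤ w`: `Σ_{j ≤ m} binom(dim S̄, j) ≤ #{v ∈ S̄ : wt v ≤ mw} = Σ_{i ≤ mw} A_i`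
  (`A_i = wtDist S̄ i`, `QuaternaryMacWilliams.lean`), for EVERY `m`; `…_theorem_IV8_additiveCode` — the printed form
  with `dim S̄ = n − k` for an `[[n,k,d]]` additive code (`IsAdditiveCode`);
* **`CSSCode.WangLiuLiKubicaGu2026_theorem_IV5_X` / `_Z`** — for a check-matrix CSS code (`CSS.lean`) whose `X`-rows
  (resp. `Z`-rows) have Hamming weight `≤ w`: `Σ_{j ≤ m} binom(rank H^X, j) ≤ #{x ∈ rs H^X : |x| ≤ mw}` (and
  `rank H^X = n − k_X` where `k_X = dim ker H^X`… in the paper's notation `C_X = ker`-side code, `C_X^⊥ = rs H^X`).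

The printed range `m ≤ ⌊n/w⌋` is where the constraint is informative; the inequality holds for all `m` and is stated
so. The printed lower summation index in (17) is `i = 1` while Theorem IV.5 prints `i = 0`; with `A_0 = 1` counting
the empty product the correct (and proved) reading is `i = 0` — see `scope_caveats` in the docstring of
`WangLiuLiKubicaGu2026_theorem_IV8`.

## References (locators read on the page)

* [WangLiuLiKubicaGu2026] arXiv:2601.15446: §IV.A Definition IV.1 and Theorem IV.5 (held text p0012 L32–58,
  L132–162), §IV.B Definition IV.6, Theorems IV.7–IV.8 and proof (p0013 L25–79).
* [CalderbankEtAl1998] CRSS, IEEE Trans. IT 44 (1998) 1369, §3 (weight distribution of an additive code) — the tree's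
  `wtDist`, `codeWords` (`QuaternaryMacWilliams.lean`).

## Mathlib / tree search (2026-08-27)

Tree: `wtDist`, `codeWords`, `CRSSLPFeasible`/`CRSS1998_theorem21_LP_holds` (the LP these constraints extend),
`sympWeight_add_le` (`SyndromeDecodingAdditive.lean`), `rowSpace`, `finrank_rowSpace_eq_rank` (`CSS.lean`); no
existing check-weight LP constraint (`rg "check weight|checkWeight"`: only `CheckWeightThreeDistanceBound.lean`).
Mathlib: `Finset.le_sum_of_subadditive`, `Fintype.linearIndependent_iff`, `exists_linearIndependent`,
`finrank_span_eq_card`, `Finset.card_le_card_of_injOn`, `Finset.mem_powersetCard_univ`, `Finset.card_powersetCard`.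
-/

namespace Literature.InformationTheory.QuantumCodes

open Finset Module

/-! ### Subset sums of light independent vectors -/

section Generic

variable {V : Type*} [AddCommGroup V] [Module (ZMod 2) V] [Fintype V]

omit [Fintype V] in
/-- In an `𝔽₂`-space `x + x = 0`. [folklore] -/
private theorem add_self_eq_zero_F2 (x : V) : x + x = 0 := by
  rw [← two_smul (ZMod 2) x, show (2 : ZMod 2) = 0 from rfl, zero_smul]

/-- `Σ_{j ≤ m} binom(r, j)` counts the subsets of `Fin r` of size `≤ m`. [folklore] -/
private theorem sum_choose_eq_card_filter (r m : ℕ) :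
    ∑ j ∈ range (m + 1), r.choose j = #((univ : Finset (Finset (Fin r))).filter fun J => #J ≤ m) := by
  rw [card_eq_sum_card_fiberwise (f := fun J : Finset (Fin r) => #J) (t := range (m + 1))
    (fun J hJ => mem_range.2 (Nat.lt_succ_of_le (mem_filter.1 hJ).2))]
  refine sum_congr rfl fun j hj => ?_
  have : ((univ : Finset (Finset (Fin r))).filter fun J => #J ≤ m).filter (fun J => #J = j) = powersetCard j univ := by
    ext J
    simp only [mem_filter, mem_univ, true_and, mem_powersetCard_univ]
    constructor
    · exact fun h => h.2
    · intro h; exact ⟨by rw [h]; exact Nat.le_of_lt_succ (mem_range.1 hj), h⟩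
  rw [this, card_powersetCard, card_univ, Fintype.card_fin]

open scoped Classical in
/-- **Subset sums of light independent vectors.** If `g_1, …, g_r` are linearly independent over `𝔽₂` and each has
weight `≤ w` for a weight `wt` with `wt 0 = 0`, `wt (x + y) ≤ wt x + wt y`, then the span contains at least
`Σ_{j ≤ m} binom(r, j)` vectors of weight `≤ m·w` — the sums over subsets of size `≤ m`, pairwise distinct by
independence. [cite: WangLiuLiKubicaGu2026, §IV.B proof of Theorem IV.8 (arXiv:2601.15446 p. 13: «any product of at most m linearly independent checks gives a unique stabilizer of weight at most mw»)] -/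
theorem choose_sum_le_card_span_of_weight_le {r : ℕ} (g : Fin r → V) (hg : LinearIndependent (ZMod 2) g)
    (wt : V → ℕ) (hwt0 : wt 0 = 0) (hadd : ∀ x y, wt (x + y) ≤ wt x + wt y) {w : ℕ} (hw : ∀ i, wt (g i) ≤ w)
    (m : ℕ) :
    ∑ j ∈ range (m + 1), r.choose j ≤
      #(univ.filter fun x : V => x ∈ Submodule.span (ZMod 2) (Set.range g) ∧ wt x ≤ m * w) := by
  rw [sum_choose_eq_card_filter]
  refine card_le_card_of_injOn (fun J => ∑ i ∈ J, g i) (fun J hJ => ?_) (fun J hJ J' hJ' hJJ' => ?_)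
  · rw [mem_coe, mem_filter] at hJ ⊢
    refine ⟨mem_univ _, Submodule.sum_mem _ fun i _ => Submodule.subset_span ⟨i, rfl⟩, ?_⟩
    refine (Finset.le_sum_of_subadditive wt (le_of_eq hwt0) hadd J g).trans ?_
    refine (sum_le_card_nsmul J (fun i => wt (g i)) w fun i _ => hw i).trans ?_
    rw [smul_eq_mul]
    exact Nat.mul_le_mul_right w hJ.2
  · -- injectivity: `Σ_J g = Σ_{J'} g` forces `J = J'` by linear independence
    simp only at hJJ'
    have key : ∀ T : Finset (Fin r), ∑ i, (if i ∈ T then (1 : ZMod 2) else 0) • g i = ∑ i ∈ T, g i := by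
      intro T
      simp only [ite_smul, one_smul, zero_smul]
      rw [sum_ite_mem, univ_inter]
    let c : Fin r → ZMod 2 := fun i => (if i ∈ J then (1 : ZMod 2) else 0) + (if i ∈ J' then (1 : ZMod 2) else 0)
    have hsum : ∑ i, c i • g i = 0 := by
      simp only [c, add_smul, sum_add_distrib, key, hJJ', add_self_eq_zero_F2]
    have hli := (Fintype.linearIndependent_iff.1 hg) c hsum
    ext i
    have hi := hli i
    simp only [c] at hi
    by_cases h1 : i ∈ J <;> by_cases h2 : i ∈ J'
    · exact iff_of_true h1 h2
    · simp [h1, h2] at hi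
    · simp [h1, h2] at hi
    · exact iff_of_false h1 h2

end Generic

/-! ### Theorem IV.8: stabilizer codes -/

section Stabilizer

variable {n : ℕ}

open scoped Classical in
/-- **Wang–Liu–Li–Kubica–Gu 2026, Theorem IV.8 (check-weight constraint, stabilizer codes).** If the stabilizer space
`S̄ ≤ 𝔽₂^{2n}` is spanned by vectors of symplectic weight `≤ w` (the code «has check weight `w`»), then for every `m`
the number of stabilizers of weight `≤ mw` is at least `Σ_{j=0}^{m} binom(dim S̄, j)`. Printed for `[[n,k,d]]` codes
with `dim S̄ = n − k` and `m ≤ ⌊n/w⌋` (`…_additiveCode` below). scope_caveats: eq. (17) prints the left sum from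
`i = 1`; the proof («products of AT MOST m checks», including the empty product) and Theorem IV.5 give `i = 0`, which
is what is proved here. [cite: WangLiuLiKubicaGu2026, §IV.B Theorem IV.8 and proof (arXiv:2601.15446 p. 13, eq. (17))] -/
theorem WangLiuLiKubicaGu2026_theorem_IV8 (S : Submodule (ZMod 2) (SympVec n)) {w : ℕ}
    (hgen : ∃ G : Set (SympVec n), Submodule.span (ZMod 2) G = S ∧ ∀ g ∈ G, sympWeight g ≤ w) (m : ℕ) :
    ∑ j ∈ range (m + 1), (finrank (ZMod 2) S).choose j ≤ #((codeWords S).filter fun v => sympWeight v ≤ m * w) := by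
  classical
  obtain ⟨G, hGS, hGw⟩ := hgen
  obtain ⟨b, hbG, hbspan, hbli⟩ := exists_linearIndependent (ZMod 2) G
  haveI : Fintype b := Fintype.ofFinite b
  -- reindex the basis by `Fin r`
  set r := Fintype.card b
  let e : Fin r ≃ b := (Fintype.equivFin b).symm
  have hli : LinearIndependent (ZMod 2) (fun i : Fin r => ((e i : b) : SympVec n)) := hbli.comp e e.injective
  have hrange : Set.range (fun i : Fin r => ((e i : b) : SympVec n)) = b := by
    ext v
    constructor
    · rintro ⟨i, rfl⟩; exact (e i).2
    · intro hv; exact ⟨e.symm ⟨v, hv⟩, by simp⟩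
  have hspan : Submodule.span (ZMod 2) (Set.range fun i : Fin r => ((e i : b) : SympVec n)) = S := by
    rw [hrange, hbspan, hGS]
  have hr : finrank (ZMod 2) S = r := by
    rw [← hspan, finrank_span_eq_card hli, Fintype.card_fin]
  have h := choose_sum_le_card_span_of_weight_le _ hli sympWeight ((sympWeight_eq_zero_iff _).2 rfl) sympWeight_add_le
    (w := w) (fun i => hGw _ (hbG (e i).2)) m
  rw [hr]
  rw [hspan] at h
  refine h.trans (le_of_eq (congrArg card ?_))
  ext v
  simp [mem_codeWords]

open scoped Classical in
/-- `#{v ∈ S̄ : wt v ≤ M} = Σ_{i ≤ M} A_i` in the tree's `wtDist` notation. [cite: CalderbankEtAl1998, §3 (printed p. 12, the weight distribution `A_j`)] -/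
theorem card_codeWords_filter_le_eq_sum_wtDist (S : Submodule (ZMod 2) (SympVec n)) (M : ℕ) :
    #((codeWords S).filter fun v => sympWeight v ≤ M) = ∑ i ∈ range (M + 1), wtDist S i := by
  classical
  rw [card_eq_sum_card_fiberwise (f := sympWeight) (t := range (M + 1))
    (fun v hv => mem_range.2 (Nat.lt_succ_of_le (mem_filter.1 hv).2))]
  refine sum_congr rfl fun i hi => ?_
  unfold wtDist
  congr 1
  ext v
  simp only [mem_filter]
  constructor
  · rintro ⟨⟨hv, -⟩, h⟩; exact ⟨hv, h⟩
  · rintro ⟨hv, h⟩; exact ⟨⟨hv, by rw [h]; exact Nat.le_of_lt_succ (mem_range.1 hi)⟩, h⟩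

/-- **Theorem IV.8, printed form**: for an `[[n,k,d]]` additive code whose stabilizer space is spanned by words of
weight `≤ w`, `Σ_{j=0}^{m} binom(n − k, j) ≤ Σ_{i=0}^{mw} A_i` for every `m`.
[cite: WangLiuLiKubicaGu2026, §IV.B Theorem IV.8 (arXiv:2601.15446 p. 13, eq. (17))] -/
theorem WangLiuLiKubicaGu2026_theorem_IV8_additiveCode {S : Submodule (ZMod 2) (SympVec n)} {k d w : ℕ}
    (hS : IsAdditiveCode S k d) (hgen : ∃ G : Set (SympVec n), Submodule.span (ZMod 2) G = S ∧ ∀ g ∈ G, sympWeight g ≤ w)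
    (m : ℕ) : ∑ j ∈ range (m + 1), (n - k).choose j ≤ ∑ i ∈ range (m * w + 1), wtDist S i := by
  have hdim : finrank (ZMod 2) S = n - k := by have := hS.2.1; omega
  rw [← card_codeWords_filter_le_eq_sum_wtDist, ← hdim]
  exact WangLiuLiKubicaGu2026_theorem_IV8 S hgen m

end Stabilizer

/-! ### Theorem IV.5: CSS codes -/

namespace CSSCode

variable {RX RZ Q : Type*} [Fintype RX] [Fintype RZ] [Fintype Q] [DecidableEq Q]

omit [Fintype Q] [DecidableEq Q] in
/-- `rs H = span (rows)`. [cite: NielsenChuang2010, §10.4.1 p. 449 (C^⊥ has generator matrix Hᵀ)] -/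
private theorem rowSpace_eq_span_range' {R : Type*} [Fintype R] (H : Matrix R Q (ZMod 2)) :
    rowSpace H = Submodule.span (ZMod 2) (Set.range H) := by
  rw [show rowSpace H = Submodule.span (ZMod 2) (Set.range H.row) from range_vecMulLinear H]
  rfl

/-- Hamming weight is subadditive over `𝔽₂`. [folklore] -/
private theorem hammingNorm_add_le' (x y : Q → ZMod 2) : hammingNorm (x + y) ≤ hammingNorm x + hammingNorm y := by
  unfold hammingNorm
  refine le_trans (card_le_card fun i hi => ?_) (card_union_le _ _)
  simp only [mem_filter, mem_univ, true_and, mem_union, Pi.add_apply] at hi ⊢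
  by_contra h
  push Not at h
  exact hi (by rw [h.1, h.2, add_zero])

open scoped Classical in
omit [Fintype RZ] in
/-- **Wang–Liu–Li–Kubica–Gu 2026, Theorem IV.5 (1) (check-weight constraint, CSS codes, `X` side).** If every `X`-check
(row of `H^X`) has weight `≤ w`, then for every `m` the number of `X`-stabilizers (words of `rs H^X = C_X^⊥`,
Definition IV.1) of weight `≤ mw` is at least `Σ_{j=0}^{m} binom(rank H^X, j)`; `rank H^X = dim C_X^⊥ = n − k_X`.
[cite: WangLiuLiKubicaGu2026, §IV.A Theorem IV.5 (1) with Definition IV.1 (arXiv:2601.15446 p. 12)] -/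
theorem WangLiuLiKubicaGu2026_theorem_IV5_X (C : CSSCode RX RZ Q) {w : ℕ} (hX : ∀ r, hammingNorm (C.HX r) ≤ w) (m : ℕ) :
    ∑ j ∈ range (m + 1), C.HX.rank.choose j ≤
      #(univ.filter fun x : Q → ZMod 2 => x ∈ C.rowSpX ∧ hammingNorm x ≤ m * w) := by
  classical
  obtain ⟨b, hbG, hbspan, hbli⟩ := exists_linearIndependent (ZMod 2) (Set.range C.HX)
  haveI : Fintype b := Fintype.ofFinite b
  set r := Fintype.card b
  let e : Fin r ≃ b := (Fintype.equivFin b).symm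
  have hli : LinearIndependent (ZMod 2) (fun i : Fin r => ((e i : b) : Q → ZMod 2)) := hbli.comp e e.injective
  have hrange : Set.range (fun i : Fin r => ((e i : b) : Q → ZMod 2)) = b := by
    ext v
    constructor
    · rintro ⟨i, rfl⟩; exact (e i).2
    · intro hv; exact ⟨e.symm ⟨v, hv⟩, by simp⟩
  have hspan : Submodule.span (ZMod 2) (Set.range fun i : Fin r => ((e i : b) : Q → ZMod 2)) = C.rowSpX := by
    rw [hrange, hbspan, ← rowSpace_eq_span_range']
  have hr : C.HX.rank = r := by
    rw [← finrank_rowSpace_eq_rank, show rowSpace C.HX = C.rowSpX from rfl, ← hspan, finrank_span_eq_card hli,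
      Fintype.card_fin]
  have hw : ∀ i : Fin r, hammingNorm ((e i : b) : Q → ZMod 2) ≤ w := by
    intro i
    obtain ⟨r', hr'⟩ := hbG (e i).2
    rw [← hr']; exact hX r'
  have h := choose_sum_le_card_span_of_weight_le _ hli hammingNorm hammingNorm_zero hammingNorm_add_le' hw m
  rw [hr]
  rw [hspan] at h
  exact h

open scoped Classical in
omit [Fintype RX] in
/-- **Theorem IV.5 (2)**, the `Z` side: `Σ_{j ≤ m} binom(rank H^Z, j) ≤ #{z ∈ rs H^Z : |z| ≤ mw}` when every `Z`-check
has weight `≤ w`. [cite: WangLiuLiKubicaGu2026, §IV.A Theorem IV.5 (2) (arXiv:2601.15446 p. 12)] -/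
theorem WangLiuLiKubicaGu2026_theorem_IV5_Z (C : CSSCode RX RZ Q) {w : ℕ} (hZ : ∀ s, hammingNorm (C.HZ s) ≤ w) (m : ℕ) :
    ∑ j ∈ range (m + 1), C.HZ.rank.choose j ≤
      #(univ.filter fun z : Q → ZMod 2 => z ∈ C.rowSpZ ∧ hammingNorm z ≤ m * w) :=
  C.swap.WangLiuLiKubicaGu2026_theorem_IV5_X hZ m

end CSSCode

end Literature.InformationTheory.QuantumCodes
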